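import Literature.AlgebraicGeometry.Motives.AbelianSchemeModelTwistedReductionTate
import Summits.HodgeConjecture.HodgeConjecture.Theorems.HCCMUnconditionalS5cPrimeOfTwistedReduction
import HarnessLib

/-!
# `S5c′` from the NAMED fact Q5 — the one-line bridge (cell `hodgecm-mathlib`, row II-1, edition E4 «`S5c′ ↦ Q5`»)

The Literature named fact `IsAbelianSchemeModel.forall_isTateCompatible_homReduction_conjFrob_tateSpecialisation`
(`Literature/AlgebraicGeometry/Motives/AbelianSchemeModelTwistedReductionTate.lean`; «Q5»: Tate compatibility of the
Frobenius-conjugate companions with the produced and the transported specialisation data, [Shimura1998] §18.6 «`(Y^σ)~ = Ỹ^f`»,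
§11.1 Prop. 14 (i)) IS, token for token, the hypothesis `hQ5` of
`Hyp21.exists_finite_forall_exists_goodReductionAt_homReduction_conjFrob_isTateCompatible_of_twistedReduction`
(`HCCMUnconditionalS5cPrimeOfTwistedReduction.lean`), which assembles
`S5c′` = `AbelianVariety.exists_finite_forall_exists_goodReductionAt_homReduction_conjFrob_isTateCompatible` from it.  Literature cannot
import Summits, so the bridge lives here: `factRHS5c_of_Q5 : Q5 → S5c′` (bare term) and the token-faithfulness certificate
`q5_iff_hQ5 : Q5 ↔ <the hQ5 text>` by `Iff.rfl`.  Consumers (floor edition `hc_cm_of_floor_v6/v7`, `a2_casselman_descent`,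
`b2_main_theorem_cm` v2u `FactQ5`) switch to the name at constant count.  THEOREMS ONLY (no def, no fact, no instance; debt 0).
HC_CM is proved only modulo the printed citations until rung 0 closes.
-/

set_option autoImplicit false

noncomputable section

open CategoryTheory AlgebraicGeometry IsDedekindDomain IsDedekindDomain.HeightOneSpectrum
open scoped NumberField
open Literature.NumberTheory.EllipticCurves Literature.NumberTheory.GaloisRepresentations
open Literature.NumberTheory.DiophantineGeometry Literature.NumberTheory.NumberFields
open Literature.AlgebraicGeometry.Motives Literature.AlgebraicGeometry.Motives.AbelianVariety

namespace Summit.HodgeConjecture.CorCM.Hyp21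

/-- **`S5c′` from the named fact Q5** (bare term over the landed assembly
`exists_finite_forall_exists_goodReductionAt_homReduction_conjFrob_isTateCompatible_of_twistedReduction`): the floor's binder
`hQ5` may be taken as `IsAbelianSchemeModel.forall_isTateCompatible_homReduction_conjFrob_tateSpecialisation` by name.
[cite: Shimura1998, §18.6 proof of Thm. 18.6 (pp. 128–130); §11.1 Prop. 14 (i) (p. 85)] -/
theorem factRHS5c_of_Q5 (h : IsAbelianSchemeModel.forall_isTateCompatible_homReduction_conjFrob_tateSpecialisation) :
    AbelianVariety.exists_finite_forall_exists_goodReductionAt_homReduction_conjFrob_isTateCompatible :=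
  exists_finite_forall_exists_goodReductionAt_homReduction_conjFrob_isTateCompatible_of_twistedReduction h

/-- **Token-faithfulness certificate**: the named fact Q5 unfolds, by `Iff.rfl`, to the hypothesis text `hQ5` of the landed
assembly (spelled out here exactly as in `HCCMUnconditionalS5cPrimeOfTwistedReduction.lean`), so every Q5 worker typing against
the registered slot bytes closes the named fact with the same term. [cite: Shimura1998, §18.6 proof of Thm. 18.6 (pp. 128–130)] -/
theorem q5_iff_hQ5 : IsAbelianSchemeModel.forall_isTateCompatible_homReduction_conjFrob_tateSpecialisation ↔
    ∀ {F₀ K : Type} [Field F₀] [Field K] [NumberField K] [Algebra F₀ K] {v : HeightOneSpectrum (𝓞 K)}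
      {Aᵢ Aₐ : AbelianVariety K} {𝒜ᵢ 𝒜ₐ : SchemeOver (valuationSubringAtPrime K v)} [GrpObj 𝒜ᵢ] [GrpObj 𝒜ₐ]
      (hi : IsAbelianSchemeModel Aᵢ v 𝒜ᵢ) (ha : IsAbelianSchemeModel Aₐ v 𝒜ₐ) (γ : K ≃ₐ[F₀] K)
      (hγ : IsArithFrobAt (𝓞 F₀) γ v.asIdeal) (p n : ℕ) [ExpChar v.asIdeal.ResidueField p]
      (hq : Nat.card (𝓞 F₀ ⧸ v.asIdeal.under (𝓞 F₀)) = p ^ n)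
      (σt : AlgebraicClosure K ≃+* AlgebraicClosure K)
      (hσa : ∀ a : K, σt (algebraMap K (AlgebraicClosure K) a) = algebraMap K (AlgebraicClosure K) (γ.toRingEquiv a))
      (ℓ : ℕ) [Fact ℓ.Prime] (hℓv : ((ℓ : ℕ) : 𝓞 K) ∉ v.asIdeal)
      (hσ𝔓 : ∀ x : absIntegers (𝓞 K) K, ∃ hx : σt x ∈ absIntegers (𝓞 K) K,
        (⟨σt x, hx⟩ : absIntegers (𝓞 K) K) - x ^ Nat.card (𝓞 F₀ ⧸ v.asIdeal.under (𝓞 F₀)) ∈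
          (ha.tateSpecialisation ℓ hℓv).prime)
      (Hγ : GoodReductionAt.HomReduction hi.goodReductionAt (ha.goodReductionAt.conjFrob γ hγ p n hq))
      (Hγ' : GoodReductionAt.HomReduction (ha.goodReductionAt.conjFrob γ hγ p n hq) hi.goodReductionAt),
      Hγ.IsTateCompatible (hi.tateSpecialisation ℓ hℓv)
          ((ha.tateSpecialisation ℓ hℓv).conjFrob γ hγ p n hq σt hσa hσ𝔓) ∧
        Hγ'.IsTateCompatible ((ha.tateSpecialisation ℓ hℓv).conjFrob γ hγ p n hq σt hσa hσ𝔓)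
          (hi.tateSpecialisation ℓ hℓv) :=
  Iff.rfl

end Summit.HodgeConjecture.CorCM.Hyp21

end
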